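import Literature.Geometry.Symplectic.AlmostComplexTangentSection
import Literature.Geometry.Symplectic.CanonicalClass
import Literature.AlgebraicTopology.CharacteristicClasses.TopChernClassSection
import HarnessLib

/-!
# An almost complex manifold with a nowhere-zero vector field has vanishing top Chern class

D. McDuff, D. Salamon, *Introduction to Symplectic Topology*, 3rd ed. (2017), §2.6–§2.7 (the
tangent bundle `(TM, J)` of an almost complex manifold as a complex vector bundle of rank
`k = dim M / 2`, its Chern classes, and, Ex. 4.4.3 (v), "`⟨c₂(TX), [X]⟩ … is the Euler
characteristic" in dimension `4`), with D. Husemoller, *Fibre Bundles* (3rd ed. 1994), Ch. 17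
Thm. 8.3 and Exercise 1, and J. Milnor, J. Stasheff, *Characteristic Classes* (1974),
Property 9.7 with §14: the top Chern class `c_k` of a complex `k`-plane bundle with an
everywhere-nonzero cross section vanishes.

Applied to the section `x ↦ β_x (Y x)` of `(TM, J)` attached to a vector field `Y`
(`AlmostComplexStructure.fieldSection`, `continuous_fieldSection`, `fieldSection_eq_zero_iff`,
`AlmostComplexTangentSection.lean`) and the tree's
`ComplexVectorBundle.chernClassZ_eq_zero_of_section` (`TopChernClassSection.lean`):

* **`AlmostComplexStructure.chernClass_eq_zero_of_vectorField`** — if `M` (Hausdorff,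
  paracompact) carries a continuous vector field `Y` with `Y x ≠ 0` for all `x`, then
  `cᵢ(TM, J) = 0` for every `i ≥ dim M / 2`, `i ≥ 1`; in particular the top class
  `c_{dim M / 2}(TM, J) = 0` (`chernClass_half_dim_eq_zero_of_vectorField`).

This is the complement-of-the-zero-set step of the computation
`⟨c_k(TM, J), [M]⟩ = Σ_{p ∈ Z(Y)} ind_p(Y) = χ(M)` of the top Chern number of a closed almost
complex manifold (the input `⟨c₂(TX, J), [X]⟩ = χ(X)` of the Hirzebruch–Wu formula
`c₁² = 2χ + 3σ`, `hirzebruchWu_of_signatureFormula_of_topChernNumber`).  Everything is proved;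
no definitions, no named facts.

## References

* D. McDuff, D. Salamon, *Introduction to Symplectic Topology*, 3rd ed., OUP 2017, §2.6, §2.7,
  Ex. 4.4.3 (v). [McDuffSalamon2017]
* D. Husemoller, *Fibre Bundles*, 3rd ed., GTM 20, Springer 1994, Ch. 17 Thm. 8.3 and
  Exercise 1. [HusemollerFibreBundles1994]
* J. Milnor, J. Stasheff, *Characteristic Classes*, Ann. of Math. Stud. 76, PUP 1974,
  Property 9.7, §14. [MilnorStasheff1974]
-/

noncomputable section

open scoped Manifold ContDiff Topology
open Module Bundle Literature.AlgebraicTopology.CharacteristicClasses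

namespace Literature.Geometry.Symplectic

namespace AlmostComplexStructure

variable {E : Type*} [NormedAddCommGroup E] [NormedSpace ℝ E] [FiniteDimensional ℝ E]
  {H : Type*} [TopologicalSpace H] {I : ModelWithCorners ℝ E H}
  {M : Type} [TopologicalSpace M] [ChartedSpace H M] [IsManifold I 1 M] {n : WithTop ℕ∞}
  (J : AlmostComplexStructure I n M)

/-- The section `x ↦ β_x (Y x)` of `(TM, J)` attached to a nowhere-zero vector field is nowhere
zero. [folklore] -/
theorem fieldSection_ne_zero {Y : Π x : M, TangentSpace I x} (hY0 : ∀ x, Y x ≠ 0) (x : M) :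
    J.fieldSection Y x ≠ 0 :=
  fun h ↦ hY0 x ((J.fieldSection_eq_zero_iff Y x).1 h)

variable [T2Space M] [ParacompactSpace M]

/-- **A nowhere-zero continuous vector field kills the Chern classes `cᵢ(TM, J)`, `i ≥ dim M / 2`,
`i ≥ 1`** (Husemoller, *Fibre Bundles*, Ch. 17 Thm. 8.3 with Exercise 1; Milnor–Stasheff,
Property 9.7 and §14 — the top Chern class of a bundle with an everywhere-nonzero section
vanishes — for the complex tangent bundle `(TM, J)` of rank `dim M / 2`, McDuff–Salamon §2.6,
and its section `x ↦ β_x(Y x)`; the classes above the rank vanish by (C₀)).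
[cite: HusemollerFibreBundles1994, Ch. 17 Thm. 8.3 and Ch. 17 Exercise 1]
[cite: McDuffSalamon2017, §2.6 and §2.7] -/
theorem chernClass_eq_zero_of_vectorField {Y : Π x : M, TangentSpace I x}
    (hY : Continuous fun x ↦ (⟨x, Y x⟩ : TangentBundle I M)) (hY0 : ∀ x, Y x ≠ 0)
    {i : ℕ} (hi : finrank ℝ E / 2 ≤ i) (hi0 : 0 < i) : J.chernClass i = 0 :=
  J.complexTangentBundle.chernClassZ_eq_zero_of_section (J.fieldSection Y)
    (J.continuous_fieldSection hY) (J.fieldSection_ne_zero hY0)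
    ((le_of_eq J.rank_complexTangentBundle).trans hi) hi0

/-- **In particular the top Chern class `c_{dim M / 2}(TM, J)` of an almost complex manifold
(`dim M ≥ 2`) with a nowhere-zero continuous vector field vanishes.**
[cite: HusemollerFibreBundles1994, Ch. 17 Thm. 8.3 and Ch. 17 Exercise 1]
[cite: MilnorStasheff1974, Property 9.7 and §14] -/
theorem chernClass_half_dim_eq_zero_of_vectorField {Y : Π x : M, TangentSpace I x}
    (hY : Continuous fun x ↦ (⟨x, Y x⟩ : TangentBundle I M)) (hY0 : ∀ x, Y x ≠ 0)
    (hk : 0 < finrank ℝ E / 2) : J.chernClass (finrank ℝ E / 2) = 0 :=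
  J.chernClass_eq_zero_of_vectorField hY hY0 le_rfl hk

end AlmostComplexStructure

end Literature.Geometry.Symplectic

end
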